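import Summits.NavierStokesRegularity.NavierStokesRegularity.Theorems.ExtremiserTransienceNearExtremalTransienceExtremiserLiouvilleConstantSpeedL2FluxEstimate
import Literature.Analysis.FluidPDE.CylindricalIntegration
import Mathlib.Analysis.SpecialFunctions.JapaneseBracket
import HarnessLib

/-!
# Crux `ExtremiserTransience.NearExtremalTransience` (stmt-NavierStokesRegularity-21883), line `extremiser_liouville`,
# stub K1b — decay-gap Liouville, TOOLS: the slab majorant (Fubini in cylindrical variables) and small lemmas

`--supports stmt-NavierStokesRegularity-21883` (helper).  Author: prover seat `ns-el-k1b` (g4).  Tools for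
`…ConstantSpeedDecayLiouville` (a constant-speed divergence-free `C¹` field with `‖w − c‖ = O(|x|^{-a})`, `a > 1`, is constant).

* `integrable_slab_cylRadius_rpow`: for `p > 2`, `L ≥ 0`, the slab majorant `𝟙_{|x₂| ≤ L}(1 + |x_h|)^{-p}` is integrable
  on `ℝ³` with `∫ = 2L · ∫_{ℝ²}(1 + |y|)^{-p} dy` (Fubini along the tree's `cylSplit : ℝ³ ≃ᵐ ℝ × ℝ²`, `integral_prod_mul`,
  Mathlib's `integrable_one_add_norm` in the plane);
* `rpow_neg_two_mul_le_slab`: on `T ≤ |x₂|`, `(1+‖x‖)^{-2a} ≤ (1+T)^{-(a-1)}(1+|x_h|)^{-(a+1)}` (`a > 1`);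
* `fderiv_cutoff_real_eq_zero_of_notMem` (the one-dimensional `k_T'` lives on `T ≤ |s| ≤ 2T`), `cylRadius_eq_norm_sub_smul`,
  `sq_norm_le_of_decay`, `volume_solidCylinder_toReal` (`= 2h r² |B₁(ℝ²)|`),
  `integrable_axialCutoff_weight_of_decay` (`k_T(x₂)‖V‖²/(1+⟪c,x⟫²) ∈ L¹` under the decay hypothesis).

WHAT THIS IS NOT: K1b is NOT proved; nothing here proves NS regularity. [folklore]
-/
noncomputable section

open Set Filter Topology MeasureTheory Metric Function
open scoped ENNReal NNReal Topology InnerProductSpace RealInnerProductSpace ContDiff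
open Literature.Analysis.FluidPDE Literature.Analysis

namespace Summit.NavierStokesRegularity.NavierStokesRegularity.Theorems

-- the problem directory repeats the summit name (`NavierStokesRegularity/NavierStokesRegularity`)
set_option linter.dupNamespace false

namespace ExtremiserLiouville

/-! ## The slab majorant `𝟙_{|x₂| ≤ L} (1 + |x_h|)^{-p}`, `p > 2` (Fubini in cylindrical variables) -/

/-- `|x₂| ≤ ‖x‖` and `cylRadius x ≤ ‖x‖`. [folklore] -/
theorem abs_two_le_norm_and_cylRadius_le_norm (x : EuclideanSpace ℝ (Fin 3)) :
    |x 2| ≤ ‖x‖ ∧ cylRadius x ≤ ‖x‖ := by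
  obtain ⟨h1, h2⟩ := closedBall_subset_solidCylinder ‖x‖ (mem_closedBall_zero_iff.2 le_rfl)
  exact ⟨h2, h1⟩

/-- **The planar constant** `I_p = ∫_{ℝ²} (1 + |y|)^{-p} < ∞` for `p > 2`. [folklore] -/
theorem integrable_one_add_norm_two {p : ℝ} (hp : 2 < p) :
    Integrable (fun w : EuclideanSpace ℝ (Fin 2) => (1 + ‖w‖) ^ (-p)) volume :=
  integrable_one_add_norm (by rw [finrank_euclideanSpace, Fintype.card_fin]; exact_mod_cast hp)

/-- **The slab majorant is integrable on `ℝ³` and `∫ 𝟙_{|x₂| ≤ L}(1 + |x_h|)^{-p} = 2L · I_p`** (`L ≥ 0`, `p > 2`;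
Fubini along `cylSplit : ℝ³ ≃ ℝ × ℝ²`). [folklore] -/
theorem integrable_slab_cylRadius_rpow {p : ℝ} (hp : 2 < p) {L : ℝ} (hL : 0 ≤ L) :
    Integrable (fun x : EuclideanSpace ℝ (Fin 3) =>
      ({x : EuclideanSpace ℝ (Fin 3) | |x 2| ≤ L}).indicator (fun x => (1 + cylRadius x) ^ (-p)) x) volume ∧
    (∫ x : EuclideanSpace ℝ (Fin 3), ({x : EuclideanSpace ℝ (Fin 3) | |x 2| ≤ L}).indicator
        (fun x => (1 + cylRadius x) ^ (-p)) x) =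
      2 * L * ∫ w : EuclideanSpace ℝ (Fin 2), (1 + ‖w‖) ^ (-p) := by
  set G : EuclideanSpace ℝ (Fin 3) → ℝ := fun x =>
    ({x : EuclideanSpace ℝ (Fin 3) | |x 2| ≤ L}).indicator (fun x => (1 + cylRadius x) ^ (-p)) x with hG
  set f : ℝ → ℝ := (Icc (-L) L).indicator fun _ => (1 : ℝ) with hf
  set g : EuclideanSpace ℝ (Fin 2) → ℝ := fun w => (1 + ‖w‖) ^ (-p) with hg
  have hfg : (fun q : ℝ × EuclideanSpace ℝ (Fin 2) => G (cylSplit.symm q)) = fun q => f q.1 * g q.2 := by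
    funext q
    rcases q with ⟨z, w⟩
    by_cases hz : |z| ≤ L
    · have h1 : cylSplit.symm (z, w) ∈ {x : EuclideanSpace ℝ (Fin 3) | |x 2| ≤ L} := by simpa using hz
      have h2 : z ∈ Icc (-L) L := by rw [mem_Icc]; exact abs_le.1 hz
      simp only [hG, hf, hg, indicator_of_mem h1, indicator_of_mem h2, cylRadius_cylSplit_symm, one_mul]
    · have h1 : cylSplit.symm (z, w) ∉ {x : EuclideanSpace ℝ (Fin 3) | |x 2| ≤ L} := by simpa using hz
      have h2 : z ∉ Icc (-L) L := by rw [mem_Icc]; exact fun h => hz (abs_le.2 h)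
      simp only [hG, hf, hg, indicator_of_notMem h1, indicator_of_notMem h2, zero_mul]
  have hfi : Integrable f volume := by
    rw [hf, integrable_indicator_iff measurableSet_Icc]
    exact integrableOn_const (by rw [Real.volume_Icc]; exact ENNReal.ofReal_lt_top.ne)
  have hgi : Integrable g volume := integrable_one_add_norm_two hp
  have hprod : Integrable (fun q : ℝ × EuclideanSpace ℝ (Fin 2) => f q.1 * g q.2) volume := by
    rw [Measure.volume_eq_prod]; exact hfi.mul_prod hgi
  have hGi : Integrable G volume := by
    rw [← integrable_comp_cylSplit_symm_iff, hfg]; exact hprod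
  refine ⟨hGi, ?_⟩
  rw [integral_eq_integral_cylSplit G, hfg, Measure.volume_eq_prod, integral_prod_mul]
  congr 1
  rw [hf, integral_indicator measurableSet_Icc, setIntegral_const, Real.volume_real_Icc_of_le (by linarith)]
  simp only [smul_eq_mul, mul_one]
  ring

/-- The pointwise split on the slab: for `a > 1` and `T ≤ |x₂|`,
`(1 + ‖x‖)^{-2a} ≤ (1 + T)^{-(a-1)} · (1 + cylRadius x)^{-(a+1)}`. [folklore] -/
theorem rpow_neg_two_mul_le_slab {a T : ℝ} (ha : 1 < a) (hT : 0 ≤ T) {x : EuclideanSpace ℝ (Fin 3)} (hx : T ≤ |x 2|) :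
    (1 + ‖x‖) ^ (-(2 * a)) ≤ (1 + T) ^ (-(a - 1)) * (1 + cylRadius x) ^ (-(a + 1)) := by
  obtain ⟨h2, hr⟩ := abs_two_le_norm_and_cylRadius_le_norm x
  have hx0 : 0 < 1 + ‖x‖ := by positivity
  have hsplit : (1 + ‖x‖) ^ (-(2 * a)) = (1 + ‖x‖) ^ (-(a - 1)) * (1 + ‖x‖) ^ (-(a + 1)) := by
    rw [← Real.rpow_add hx0]; congr 1; ring
  rw [hsplit]
  refine mul_le_mul ?_ ?_ (by positivity) (by positivity)
  · exact Real.rpow_le_rpow_of_nonpos (by positivity) (by linarith) (by linarith)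
  · exact Real.rpow_le_rpow_of_nonpos (by have := cylRadius_nonneg x; positivity) (by linarith) (by linarith)


/-! ## Small tools -/

/-- The derivative of the one-dimensional cut-off `k_T` vanishes off `T ≤ |s| ≤ 2T`. [folklore] -/
theorem fderiv_cutoff_real_eq_zero_of_notMem {T : ℝ} (hT : 0 < T) {s : ℝ} (hs : ¬ (T ≤ |s| ∧ |s| ≤ 2 * T)) :
    fderiv ℝ (cutoff (E := ℝ) T) s = 0 := by
  rcases not_and_or.1 hs with h | h
  · rw [not_le] at h
    have hev : cutoff (E := ℝ) T =ᶠ[𝓝 s] fun _ => (1 : ℝ) := by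
      filter_upwards [(isOpen_lt continuous_norm continuous_const).mem_nhds
        (show s ∈ {b : ℝ | ‖b‖ < T} by simpa [Real.norm_eq_abs] using h)] with y hy
      exact cutoff_eq_one hT (le_of_lt hy)
    rw [hev.fderiv_eq, fderiv_const_apply]
  · rw [not_le] at h
    have hev : cutoff (E := ℝ) T =ᶠ[𝓝 s] fun _ => (0 : ℝ) := by
      filter_upwards [(isOpen_lt continuous_const continuous_norm).mem_nhds
        (show s ∈ {b : ℝ | 2 * T < ‖b‖} by simpa [Real.norm_eq_abs] using h)] with y hy
      exact cutoff_eq_zero hT (le_of_lt hy)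
    rw [hev.fderiv_eq, fderiv_const_apply]

/-- `cylRadius x = ‖x − x₂ e₂‖`. [folklore] -/
theorem cylRadius_eq_norm_sub_smul (x : EuclideanSpace ℝ (Fin 3)) :
    cylRadius x = ‖x - (x 2) • EuclideanSpace.single (2 : Fin 3) (1 : ℝ)‖ := by
  obtain ⟨h0, h1, h2⟩ := transverseProj_apply x
  rw [cylRadius, EuclideanSpace.norm_eq, Fin.sum_univ_three, h0, h1, h2]
  simp [sq_abs]

/-- Squaring the decay hypothesis: `‖V x‖² ≤ C₀² (1 + ‖x‖)^{-2a}`. [folklore] -/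
theorem sq_norm_le_of_decay {V : EuclideanSpace ℝ (Fin 3) → EuclideanSpace ℝ (Fin 3)} {a C₀ : ℝ}
    (hdec : ∀ x, ‖V x‖ ≤ C₀ * (1 + ‖x‖) ^ (-a)) (x : EuclideanSpace ℝ (Fin 3)) :
    ‖V x‖ ^ 2 ≤ C₀ ^ 2 * (1 + ‖x‖) ^ (-(2 * a)) := by
  have hx0 : 0 ≤ 1 + ‖x‖ := by positivity
  have h := hdec x
  have hp : 0 ≤ (1 + ‖x‖) ^ (-a) := Real.rpow_nonneg hx0 _
  have e : (1 + ‖x‖) ^ (-(2 * a)) = ((1 + ‖x‖) ^ (-a)) ^ 2 := by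
    rw [← Real.rpow_natCast, ← Real.rpow_mul hx0]; congr 1; push_cast; ring
  rw [e, ← mul_pow]
  exact pow_le_pow_left₀ (norm_nonneg _) h 2

/-- The volume of a solid cylinder: `|{cylRadius ≤ r, |x₂| ≤ h}| = 2h · r² · |B₁(ℝ²)|` (`r, h ≥ 0`). [folklore] -/
theorem volume_solidCylinder_toReal {r h : ℝ} (hr : 0 ≤ r) (hh : 0 ≤ h) :
    (volume (solidCylinder r h)).toReal = 2 * h * r ^ 2 * (volume (ball (0 : EuclideanSpace ℝ (Fin 2)) 1)).toReal := by
  rw [volume_solidCylinder, Measure.addHaar_closedBall volume (0 : EuclideanSpace ℝ (Fin 2)) hr, finrank_euclideanSpace,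
    Fintype.card_fin, ENNReal.toReal_mul, ENNReal.toReal_mul, ENNReal.toReal_ofReal (by positivity),
    ENNReal.toReal_ofReal (by positivity)]
  ring

variable {V : EuclideanSpace ℝ (Fin 3) → EuclideanSpace ℝ (Fin 3)} {c : EuclideanSpace ℝ (Fin 3)}

/-- The weighted density `k_T(x₂) ‖V‖²/(1+⟪c,x⟫²)` is integrable under the decay hypothesis (slab majorant). [folklore] -/
theorem integrable_axialCutoff_weight_of_decay (hV : Continuous V) {a C₀ : ℝ} (ha : 1 < a)
    (hdec : ∀ x, ‖V x‖ ≤ C₀ * (1 + ‖x‖) ^ (-a)) {T : ℝ} (hT : 0 < T) :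
    Integrable (fun x => cutoff T (x 2) * (‖V x‖ ^ 2 / (1 + ⟪c, x⟫ ^ 2))) volume := by
  obtain ⟨hmaj, -⟩ := integrable_slab_cylRadius_rpow (p := 2 * a) (by linarith) (L := 2 * T) (by linarith)
  refine (hmaj.const_mul (C₀ ^ 2)).mono' ?_ (Eventually.of_forall fun x => ?_)
  · refine Continuous.aestronglyMeasurable ?_
    have h2c : Continuous fun x : EuclideanSpace ℝ (Fin 3) => x 2 := by fun_prop
    refine ((contDiff_cutoff (E := ℝ) (n := 0) T).continuous.comp h2c).mul
      ((hV.norm.pow 2).div (continuous_const.add ((continuous_const.inner continuous_id).pow 2)) fun x => ?_)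
    have : (0 : ℝ) < 1 + ⟪c, x⟫ ^ 2 := by positivity
    exact this.ne'
  · have hk01 : 0 ≤ cutoff T (x 2) ∧ cutoff T (x 2) ≤ 1 := ⟨cutoff_nonneg _ _, cutoff_le_one _ _⟩
    have hw1 : ‖V x‖ ^ 2 / (1 + ⟪c, x⟫ ^ 2) ≤ ‖V x‖ ^ 2 := div_le_self (sq_nonneg _) (by nlinarith [sq_nonneg ⟪c, x⟫])
    have hw0 : 0 ≤ ‖V x‖ ^ 2 / (1 + ⟪c, x⟫ ^ 2) := by positivity
    rw [Real.norm_eq_abs, abs_of_nonneg (mul_nonneg hk01.1 hw0)]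
    by_cases hx : |x 2| ≤ 2 * T
    · have hmem : x ∈ {x : EuclideanSpace ℝ (Fin 3) | |x 2| ≤ 2 * T} := hx
      rw [indicator_of_mem hmem]
      have h1 := sq_norm_le_of_decay hdec x
      have h2 : (1 + ‖x‖) ^ (-(2 * a)) ≤ (1 + cylRadius x) ^ (-(2 * a)) :=
        Real.rpow_le_rpow_of_nonpos (by have := cylRadius_nonneg x; positivity)
          (by linarith [(abs_two_le_norm_and_cylRadius_le_norm x).2]) (by linarith)
      calc cutoff T (x 2) * (‖V x‖ ^ 2 / (1 + ⟪c, x⟫ ^ 2)) ≤ 1 * ‖V x‖ ^ 2 :=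
            mul_le_mul hk01.2 hw1 hw0 zero_le_one
        _ ≤ C₀ ^ 2 * (1 + cylRadius x) ^ (-(2 * a)) := by rw [one_mul]; exact h1.trans (by gcongr)
    · have h0 : cutoff T (x 2) = 0 :=
        cutoff_eq_zero hT (by rw [Real.norm_eq_abs]; linarith [not_le.1 hx])
      rw [h0, zero_mul]
      exact mul_nonneg (sq_nonneg _) (indicator_nonneg (fun y _ => Real.rpow_nonneg
        (by have := cylRadius_nonneg y; positivity) _) _)

end ExtremiserLiouville

end Summit.NavierStokesRegularity.NavierStokesRegularity.Theorems

end
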